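import Literature.AlgebraicGeometry.HodgeTheory.GAGADimensionProofs
import Literature.AlgebraicGeometry.HodgeTheory.AnalytificationCartierDivisor
import Literature.AlgebraicGeometry.HodgeTheory.LefschetzOneOneChowProofs
import Literature.AlgebraicGeometry.Motives.PureCodimOneDivisor
import Literature.AlgebraicGeometry.Motives.CartierDivisorOfComplement
import HarnessLib

/-!
# GAGA: the support of the divisor of a holomorphic section — components, codimension, local equations

Support file for GAGA for line bundles (`GAGALineBundles*`; J.-P. Serre, *Géométrie algébrique et
géométrie analytique* (1956), n° 20 Remarque 1: «le diviseur `D` de `s`», the divisor of a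
meromorphic section of a holomorphic line bundle on a projective variety is algebraic). For the zero
set `S ⊆ X^h` of a holomorphic section — a closed analytic subset which is locally a HYPERSURFACE —
Chow's theorem (`chow_analyticSet_analytification_holds`) gives a Zariski-closed `Z₀` with
`S = Z₀(ℂ)`; this file supplies the algebraic bookkeeping around `Z₀`:

* `exists_finset_irredundant_components` — irredundant decomposition of a closed subset of a
  Noetherian space into closed irreducible components (plain topology);
* `coheight_eq_one_of_isLocallyHypersurface` — **every component of `Z₀` is a prime divisor**: its
  generic point has codimension `1` (a hypersurface has codimension `≤ 1` at its regular points,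
  `codim_le_one_of_isRegularPointOfCodim_of_eq_setOf`, and analytic codimension bounds algebraic
  codimension from above, `le_regularLocus_codim_of_le_coheight` = GAGA §6 Cor. 3);
* `height_eq_one_of_mem_minimalPrimes_of_isGenericPoint` — the purity hypothesis of
  `Motives/PureCodimOneDivisor` for a prime divisor, so that `ComplementDivisor.divisorOfPure` is the
  reduced effective Cartier divisor `Y_red` of each component `Y` (`X` smooth, hence locally factorial
  by Auslander–Buchsbaum, `Resolution.Matsumura1987_20_3_holds`);
* `CartierDivisor.finprod` — the divisor `Σₖ eₖ Dₖ` of a finite family, on the common refinement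
  `(⋂ₖ U_{aₖ}, ∏ₖ f_{aₖ}^{eₖ})`, with the product formula `sectionCoord_finprod` for the coordinates
  of its canonical section `1`;
* `sectionCoord_divisorOfPure`, `evalOrZero_chart_eq_zero_iff` — the coordinate of the section `1`
  of `Y_red` in a chart `(W, j)` is `m ↦ j(φ m)`, vanishing exactly over `Y`.

Everything is proved; the only definition is `CartierDivisor.finprod` (with its API).

## References

* [SerreGAGA1956] J.-P. Serre, Géométrie algébrique et géométrie analytique, Ann. Inst. Fourier 6
  (1956), §6 Prop. 3 Cor. 3, n° 19 Prop. 13, n° 20 Remarque 1.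
* [GriffithsHarrisPrinciples1978] P. Griffiths, J. Harris, Principles of Algebraic Geometry (1978),
  Ch. 1 §1 (divisors and line bundles).
* [GortzWedhorn2020] U. Görtz, T. Wedhorn, Algebraic Geometry I, 2nd ed. (2020), (11.9), Def. 11.20,
  Thm. 11.40.
-/

noncomputable section

open scoped Manifold ContDiff Topology
open CategoryTheory AlgebraicGeometry TopologicalSpace Opposite Filter Set
open Literature.AlgebraicGeometry.Motives
open Literature.AlgebraicGeometry.Motives.RatFn
open Literature.AlgebraicGeometry.Motives.AlgPoints
open Literature.NumberTheory.Transcendental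
open Literature.Geometry.Kaehler

universe u

/-! ### Irredundant decomposition into irreducible components (topology) -/

namespace Literature.AlgebraicGeometry.HodgeTheory

/-- **Irredundant decomposition of a closed subset of a Noetherian space into irreducible closed
components**: finitely many closed irreducible `Y` with union `Z`, none contained in another.
(Keep the maximal members of any finite decomposition, Mathlib
`NoetherianSpace.exists_finite_set_isClosed_irreducible`.) [folklore] -/
theorem exists_finset_irredundant_components {α : Type*} [TopologicalSpace α] [NoetherianSpace α]
    {Z : Set α} (hZ : IsClosed Z) :
    ∃ T : Finset (Set α), (∀ Y ∈ T, IsClosed Y) ∧ (∀ Y ∈ T, IsIrreducible Y) ∧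
      ⋃₀ (T : Set (Set α)) = Z ∧ ∀ Y ∈ T, ∀ Y' ∈ T, Y ⊆ Y' → Y = Y' := by
  classical
  obtain ⟨S, hSf, hSc, hSi, hSU⟩ := NoetherianSpace.exists_finite_set_isClosed_irreducible hZ
  set S' : Finset (Set α) := hSf.toFinset with hS'
  have hmemS' : ∀ Y, Y ∈ S' ↔ Y ∈ S := fun Y ↦ hSf.mem_toFinset
  refine ⟨S'.filter fun Y ↦ Maximal (· ∈ S') Y, fun Y hY ↦ hSc Y ((hmemS' Y).1 (Finset.mem_filter.1 hY).1),
    fun Y hY ↦ hSi Y ((hmemS' Y).1 (Finset.mem_filter.1 hY).1), ?_, ?_⟩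
  · apply subset_antisymm
    · intro z hz
      obtain ⟨Y, hY, hzY⟩ := mem_sUnion.1 hz
      rw [hSU]
      exact mem_sUnion.2 ⟨Y, (hmemS' Y).1 (Finset.mem_filter.1 (Finset.mem_coe.1 hY)).1, hzY⟩
    · intro z hz
      rw [hSU] at hz
      obtain ⟨Y, hY, hzY⟩ := mem_sUnion.1 hz
      obtain ⟨Y', hYY', hmax⟩ := S'.exists_le_maximal ((hmemS' Y).2 hY)
      exact mem_sUnion.2 ⟨Y', Finset.mem_coe.2 (Finset.mem_filter.2 ⟨hmax.1, hmax⟩), hYY' hzY⟩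
  · intro Y hY Y' hY' hsub
    obtain ⟨-, hmax⟩ := Finset.mem_filter.1 hY
    exact subset_antisymm hsub (hmax.2 (Finset.mem_filter.1 hY').1 hsub)

/-- In an irredundant decomposition no component lies in the union of the others. [folklore] -/
theorem not_subset_sUnion_erase_of_irredundant {α : Type*} [TopologicalSpace α]
    {T : Finset (Set α)} (hTc : ∀ Y ∈ T, IsClosed Y) (hTi : ∀ Y ∈ T, IsIrreducible Y)
    (hirr : ∀ Y ∈ T, ∀ Y' ∈ T, Y ⊆ Y' → Y = Y') {Y : Set α} (hY : Y ∈ T) :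
    ¬ Y ⊆ ⋃₀ ((T.erase Y : Finset (Set α)) : Set (Set α)) := by
  classical
  intro hsub
  obtain ⟨Y', hY', hYY'⟩ := (isIrreducible_iff_sUnion_isClosed.1 (hTi Y hY)) (T.erase Y)
    (fun Y' hY' ↦ hTc Y' (Finset.mem_of_mem_erase hY')) hsub
  have := hirr Y hY Y' (Finset.mem_of_mem_erase hY') hYY'
  exact (Finset.mem_erase.1 hY').1 this.symm

/-! ### Codimension of strict specialisations -/

/-- Strict specialisation raises the codimension: `g ⤳ x`, `g ≠ x`, `codim g ≥ l` ⟹ `codim x ≥ l + 1`.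
[cite: Hartshorne1977, II Ex. 3.20] -/
theorem add_one_le_coheight_of_specializes_of_ne {Y : Scheme.{u}} {g x : Y} (h : g ⤳ x) (hne : g ≠ x)
    {l : ℕ} (hl : (l : ℕ∞) ≤ Order.coheight g) : ((l + 1 : ℕ) : ℕ∞) ≤ Order.coheight x := by
  have hlt : x < g := by
    refine lt_of_le_not_ge (Scheme.le_iff_specializes.2 h) fun h' ↦ hne ?_
    exact (h.antisymm (Scheme.le_iff_specializes.1 h')).eq
  calc ((l + 1 : ℕ) : ℕ∞) = (l : ℕ∞) + 1 := by push_cast; rfl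
    _ ≤ Order.coheight g + 1 := add_le_add hl le_rfl
    _ ≤ Order.coheight x := Order.coheight_add_one_le hlt

/-! ### Purity of a prime divisor on the affine charts -/

set_option backward.isDefEq.respectTransparency false in
/-- **A prime divisor is pure of codimension one on every affine chart**: for `Y ⊆ X` closed with
generic point `η` of codimension `1`, every minimal prime of the radical ideal `J_V(Y) ⊆ Γ(X, V)` of
`Y` on an affine open `V` has height `1` (it is the prime of `η`: `Y ∩ V` is irreducible with generic
point `η`). This is the hypothesis `hpure` of `ComplementDivisor.divisorOfPure`.
[cite: GortzWedhorn2020, Thm. 11.40 (2) and (11.17)] -/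
theorem height_eq_one_of_mem_minimalPrimes_of_isGenericPoint {Y₀ : Scheme.{u}} {Y : Set Y₀}
    (hY : IsClosed Y) {η : Y₀} (hη : IsGenericPoint η Y) (hcoh : Order.coheight η = 1)
    (V : Y₀.Opens) (hV : IsAffineOpen V) (P : Ideal Γ(Y₀, V))
    (hP : P ∈ ((Scheme.IdealSheafData.vanishingIdeal ⟨Y, hY⟩).ideal ⟨V, hV⟩).minimalPrimes) :
    P.height = 1 := by
  haveI hPp : P.IsPrime := hP.1.1
  set J := (Scheme.IdealSheafData.vanishingIdeal ⟨Y, hY⟩).ideal ⟨V, hV⟩ with hJ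
  -- the point of `P` lies in `Y ∩ V`, so `η ∈ V`
  set q : Spec Γ(Y₀, V) := ⟨P, hPp⟩ with hq
  have hqY : hV.fromSpec q ∈ (⟨Y, hY⟩ : Closeds Y₀) := (vanishingIdeal_ideal_le_iff hV ⟨Y, hY⟩ q).1 hP.1.2
  have hηV : η ∈ V := (hη.mem_open_set_iff V.isOpen).2 ⟨hV.fromSpec q, hqY, hV.range_fromSpec.le ⟨q, rfl⟩⟩
  set pη : Spec Γ(Y₀, V) := hV.primeIdealOf ⟨η, hηV⟩ with hpη
  -- `J = 𝔭_η`: the preimage of `Y = cl {η}` is `cl {pη}`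
  have hpre : hV.fromSpec ⁻¹' Y = closure {pη} := by
    have h1 : hV.fromSpec ⁻¹' closure ({η} : Set Y₀) = closure (hV.fromSpec ⁻¹' {η}) :=
      hV.fromSpec.isOpenEmbedding.isOpenMap.preimage_closure_eq_closure_preimage hV.fromSpec.continuous _
    have h2 : hV.fromSpec ⁻¹' ({η} : Set Y₀) = {pη} := by
      ext p
      simp only [mem_preimage, mem_singleton_iff]
      constructor
      · intro hp
        apply hV.fromSpec.isOpenEmbedding.injective
        rw [hp, hpη, hV.fromSpec_primeIdealOf]
      · rintro rfl
        rw [hpη, hV.fromSpec_primeIdealOf]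
    rw [← hη.def, h1, h2]
  have hJeq : J = pη.asIdeal := by
    rw [hJ, Scheme.IdealSheafData.vanishingIdeal_ideal]
    change PrimeSpectrum.vanishingIdeal (hV.fromSpec ⁻¹' Y) = pη.asIdeal
    rw [hpre, ← PrimeSpectrum.zeroLocus_vanishingIdeal_eq_closure, PrimeSpectrum.vanishingIdeal_zeroLocus_eq_radical,
      PrimeSpectrum.vanishingIdeal_singleton, pη.2.radical]
  -- the unique minimal prime of the prime `J` is `J`
  have hPJ : P = pη.asIdeal := by
    have hmin : P ∈ (pη.asIdeal).minimalPrimes := by rw [← hJeq]; exact hP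
    rw [Ideal.minimalPrimes_eq_subsingleton_self] at hmin
    exact hmin
  rw [hPJ, idealHeight_eq_coheight, ← coheight_eq_of_isOpenImmersion hV.fromSpec, hpη,
    hV.fromSpec_primeIdealOf]
  exact hcoh

end Literature.AlgebraicGeometry.HodgeTheory

/-! ### The divisor `Σₖ eₖ Dₖ` of a finite family -/

namespace Literature.AlgebraicGeometry.Motives

namespace CartierDivisor

variable {X : Scheme.{u}} [IsIntegral X] {K : Type u} [Fintype K]

/-- Finite products of functions which are units at `x` are units at `x`. [folklore] -/
theorem _root_.Literature.AlgebraicGeometry.Motives.RatFn.isUnitAt_finset_prod {x : X} {I : Type*}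
    (s : Finset I) {g : I → X.functionField} (h : ∀ i ∈ s, IsUnitAt x (g i)) :
    IsUnitAt x (∏ i ∈ s, g i) := by
  classical
  induction s using Finset.induction_on with
  | empty => rw [Finset.prod_empty]; exact isUnitAt_one
  | insert a s ha ih =>
    rw [Finset.prod_insert ha]
    exact (h a (Finset.mem_insert_self a s)).mul (ih fun i hi ↦ h i (Finset.mem_insert_of_mem hi))

/-- Finite products of functions regular at `x` are regular at `x`. [folklore] -/
theorem _root_.Literature.AlgebraicGeometry.Motives.RatFn.isRegularAt_finset_prod {x : X} {I : Type*}
    (s : Finset I) {g : I → X.functionField} (h : ∀ i ∈ s, IsRegularAt x (g i)) :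
    IsRegularAt x (∏ i ∈ s, g i) := by
  classical
  induction s using Finset.induction_on with
  | empty => rw [Finset.prod_empty]; exact isRegularAt_one
  | insert a s ha ih =>
    rw [Finset.prod_insert ha]
    exact (h a (Finset.mem_insert_self a s)).mul (ih fun i hi ↦ h i (Finset.mem_insert_of_mem hi))

variable (D : K → CartierDivisor X) (e : K → ℕ)

/-- **The Cartier divisor `Σₖ eₖ Dₖ` of a finite family**, presented on the common refinement of the
covers: index `a = (aₖ)ₖ`, open `⋂ₖ U_{aₖ}`, local equation `∏ₖ f_{aₖ}^{eₖ}` (Görtz–Wedhorn I, (11.9):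
`Div(X)` is a group, sums taken on common refinements). [cite: GortzWedhorn2020, Section (11.9) (p. 374)] -/
def finprod : CartierDivisor X where
  ι := ∀ k, (D k).ι
  U a := Finset.univ.inf fun k ↦ (D k).U (a k)
  covers x := by
    choose i hi using fun k ↦ (D k).covers x
    refine ⟨i, ?_⟩
    change x ∈ ((Finset.univ.inf fun k ↦ (D k).U (i k) : X.Opens) : Set X)
    rw [Opens.coe_finset_inf, Finset.inf_set_eq_iInter]
    simp only [Finset.mem_univ, iInter_true, mem_iInter, Function.comp_apply]
    exact hi
  f a := ∏ k, (D k).f (a k) ^ e k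
  f_ne_zero a := Finset.prod_ne_zero_iff.2 fun k _ ↦ pow_ne_zero _ ((D k).f_ne_zero (a k))
  isUnitAt_div a b x ha hb := by
    have ha' : ∀ k, x ∈ (D k).U (a k) := by
      have : x ∈ ((Finset.univ.inf fun k ↦ (D k).U (a k) : X.Opens) : Set X) := ha
      rw [Opens.coe_finset_inf, Finset.inf_set_eq_iInter] at this
      simpa using this
    have hb' : ∀ k, x ∈ (D k).U (b k) := by
      have : x ∈ ((Finset.univ.inf fun k ↦ (D k).U (b k) : X.Opens) : Set X) := hb
      rw [Opens.coe_finset_inf, Finset.inf_set_eq_iInter] at this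
      simpa using this
    rw [← Finset.prod_div_distrib]
    refine isUnitAt_finset_prod _ fun k _ ↦ ?_
    rw [← div_pow]
    exact ((D k).isUnitAt_div (a k) (b k) x (ha' k) (hb' k)).pow (e k)

/-- The opens of `finprod` (definitional). [folklore] -/
theorem finprod_U (a : ∀ k, (D k).ι) : (finprod D e).U a = Finset.univ.inf fun k ↦ (D k).U (a k) := rfl

/-- The local equations of `finprod` (definitional). [folklore] -/
theorem finprod_f (a : ∀ k, (D k).ι) : (finprod D e).f a = ∏ k, (D k).f (a k) ^ e k := rfl

/-- Membership in the opens of `finprod`. [folklore] -/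
theorem mem_finprod_U_iff (a : ∀ k, (D k).ι) (x : X) : x ∈ (finprod D e).U a ↔ ∀ k, x ∈ (D k).U (a k) := by
  change x ∈ ((Finset.univ.inf fun k ↦ (D k).U (a k) : X.Opens) : Set X) ↔ _
  rw [Opens.coe_finset_inf, Finset.inf_set_eq_iInter]
  simp

/-- `finprod` refines each cover. [folklore] -/
theorem finprod_U_le (a : ∀ k, (D k).ι) (k : K) : (finprod D e).U a ≤ (D k).U (a k) := fun x hx ↦
  (mem_finprod_U_iff D e a x).1 hx k

variable {D} in
/-- `Σₖ eₖ Dₖ` is effective when the `Dₖ` are. [folklore] -/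
theorem isEffective_finprod (hD : ∀ k, (D k).IsEffective) : (finprod D e).IsEffective := by
  intro a x hx
  rw [finprod_f]
  exact isRegularAt_finset_prod _ fun k _ ↦ (hD k (a k) x ((mem_finprod_U_iff D e a x).1 hx k)).pow _

end CartierDivisor

end Literature.AlgebraicGeometry.Motives

/-! ### Coordinates of the section `1`: product formula, reduced divisors -/

namespace Literature.AlgebraicGeometry.HodgeTheory

variable {X : SchemeOver ℂ} [IsIntegral X.left] {M : Type*} {φ : M → ComplexPoints X}

/-- **Product formula for the coordinates of the section `1` of `Σₖ eₖ Dₖ`**: over `⋂ₖ U_{aₖ}`,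
`(∏ₖ f_{aₖ}^{eₖ})(φ m) = ∏ₖ (f_{aₖ}(φ m))^{eₖ}` (evaluation at a complex point is a ring
homomorphism). [cite: GortzWedhorn2020, Section (11.9) (p. 374)] -/
theorem sectionCoord_finprod {K : Type} [Fintype K] (D : K → CartierDivisor X.left) (e : K → ℕ)
    (hD : ∀ k, (D k).IsEffective) (a : (CartierDivisor.finprod D e).ι) {m : M}
    (hm : (φ m).pt ∈ (CartierDivisor.finprod D e).U a) :
    (CartierDivisor.finprod D e).sectionCoord φ (CartierDivisor.isEffective_finprod e hD).isSection_one a m =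
      ∏ k, ((D k).sectionCoord φ (hD k).isSection_one (a k) m) ^ e k := by
  classical
  set P := φ m with hP
  have hmk : ∀ k, P.pt ∈ (D k).U (a k) := fun k ↦ (CartierDivisor.mem_finprod_U_iff D e a _).1 hm k
  have hgen : genericPoint X.left ∈ (CartierDivisor.finprod D e).U a := genericPoint_mem_of_mem hm
  have hgenk : ∀ k, genericPoint X.left ∈ (D k).U (a k) := fun k ↦ genericPoint_mem_of_mem (hmk k)
  rw [sectionCoord_apply_of_mem _ hm]
  have hrhs : ∀ k, (D k).sectionCoord φ (hD k).isSection_one (a k) m =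
      evalOrZero ((CartierDivisor.finprod D e).U a)
        (X.left.presheaf.map (homOfLE (CartierDivisor.finprod_U_le D e a k)).op
          (sectionOf (hgenk k) ((D k).f (a k) * 1) fun y hy ↦ (hD k).isSection_one (a k) y hy)) P := by
    intro k
    rw [sectionCoord_apply_of_mem _ (hmk k), evalOrZero_map_homOfLE _ _ hm]
  simp_rw [hrhs]
  rw [evalOrZero_of_mem _ hm]
  simp_rw [evalOrZero_of_mem _ hm, ← AlgPoints.evalRingHom_apply, ← map_pow, ← map_prod]
  congr 1
  refine section_ext fun h ↦ ?_
  simp only [map_prod, map_pow, ofSection_sectionOf, ofSection_map, mul_one]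
  rfl

variable {U : X.left.Opens}

/-- The rational function of the local equation `j` of a chart `(W, j)` is `c.fn`. [folklore] -/
theorem _root_.Literature.AlgebraicGeometry.Motives.ComplementDivisor.Chart.ofSection_j
    (c : ComplementDivisor.Chart U) (h : genericPoint X.left ∈ c.W) : ofSection h c.j = c.fn :=
  ofSection_eq_toFunctionField c.pt.2 c.j

/-- **The local equation vanishes exactly over `X ∖ U`**: for a chart `(W, j)` of `X ∖ U` and a
complex point `P` of `W`, `j(P) = 0 ↔ P ∉ U`. [folklore] -/
theorem evalOrZero_chart_eq_zero_iff (c : ComplementDivisor.Chart U) {P : ComplexPoints X} (hP : P.pt ∈ c.W) :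
    evalOrZero c.W c.j P = 0 ↔ P.pt ∉ U := by
  rw [evalOrZero_of_mem _ hP, ← not_iff_not, ← Ne, ← AlgPoints.pt_mem_basicOpen_iff P hP c.j, not_not,
    ← isUnitAt_ofSection_iff hP c.j, c.ofSection_j, c.isUnitAt_iff hP]

/-- **The coordinate of the section `1` of the reduced divisor in a chart `(W, j)` is `m ↦ j(φ m)`**
over `φ⁻¹(W(ℂ))` (the local equation of `ComplementDivisor.divisorOfPure` on `W` is `j`).
[cite: GortzWedhorn2023, Lemma 25.150 (p. 670)] -/
theorem sectionCoord_divisorOfPure [IsLocallyNoetherian X.left]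
    (hUFD : ∀ x : X.left, UniqueFactorizationMonoid (X.left.presheaf.stalk x)) [Nonempty U]
    (hpure : ∀ (V : X.left.Opens) (hV : IsAffineOpen V) [Nonempty V] (P : Ideal Γ(X.left, V)),
      P ∈ ((Scheme.IdealSheafData.vanishingIdeal U.compl).ideal ⟨V, hV⟩).minimalPrimes → P.height = 1)
    (c : ComplementDivisor.Chart U) {m : M} (hm : (φ m).pt ∈ c.W) :
    (ComplementDivisor.divisorOfPure hUFD hpure).sectionCoord φ
        (ComplementDivisor.isEffective_divisorOfPure hUFD hpure).isSection_one c m =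
      evalOrZero c.W c.j (φ m) := by
  rw [sectionCoord_apply_of_mem _ (show (φ m).pt ∈ (ComplementDivisor.divisorOfPure hUFD hpure).U c from hm)]
  change evalOrZero c.W _ (φ m) = _
  congr 1
  refine section_ext fun h ↦ ?_
  rw [ofSection_sectionOf, mul_one]
  exact (c.ofSection_j h).symm

end Literature.AlgebraicGeometry.HodgeTheory

end
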